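import Mathlib
import Literature.AlgebraicGeometry.Resolution.CobordantGame
import Literature.AlgebraicGeometry.Resolution.CobordantChartCoefficients
import Literature.AlgebraicGeometry.Resolution.CobordantTupleGame
import Literature.AlgebraicGeometry.Resolution.FormalCoordinateChange
import Literature.AlgebraicGeometry.Resolution.PlaneGermBlowup
import Summits.ResolutionOfSingularities.ResolutionOfSingularities.Theorems.WeightedInvariantLocalWeightedDropBlowupScaling
import Summits.ResolutionOfSingularities.ResolutionOfSingularities.Theorems.WeightedInvariantLocalWeightedDropWildPurePowerDescentTwo

/-!
# `WeightedInvariant.LocalWeightedDrop`, line `hasse-ridge-face-selection`: the DESCENT LIFT for the purely inseparable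
# surface forms, NORMALISED — every successor in Hauser–Perlega's chart `x ↦ x, y ↦ x(t + y)`

Crux item stmt-ResolutionOfSingularities-8899 `LocalWeightedDrop` (route `ResolutionOfSingularities/WeightedInvariant`),
serving the door `WeightedConstruction` stmt-ResolutionOfSingularities-0571.  [OURS · L1 W4.3, chain w43, stub worker 1
(gen 3).  Not a statement of any manuscript.]

`purePower_won_of_descent₃` refines `purePower_won_of_descent₂` (`…WildPurePowerDescentTwo`): the descent datum is no
longer shown the game's literal successor `(s · B₀)|_{y_{i₀} = 0}` at an exceptional point `c = (c₀, c₁)`, but its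
NORMAL FORM.  At `c` the datum chooses the slot: slot `0` (`c₀ ≠ 0`) hands it the series `T` with
`x^q · T = A₁(x, x(t + y))`, `t = c₁/c₀` — `PlaneGerm.dirChart t`, the chart "`φ(x) = x, φ(y) = x(y + t)`" of
[Hauser–Perlega, PRIMS 60 (2024) §6 p. 793]; slot `1` (`c₁ ≠ 0`) hands it `T` with `x^q · T = A₁^{sw}(x, x(t + y))`,
`t = c₀/c₁`, `A₁^{sw} = A₁` with the two letters exchanged.  In both cases the new exceptional letter is `x = X 0`.
The literal successor is `c_{i₀}^q · T(c_{i₀} x, c_{i₀}⁻¹ y)` (`BlowupScaling.slice_zero_chart` and its slot-`1`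
companion `slice_one_chart_swap` here), and `y^q + c^q · T(cx, c⁻¹y)` is won iff `y^q + T` is
(`won_purePower_scale_iff`: a plane rescaling, then `y ↦ c⁻¹ y` and the unit `c^{-q}` —
`won_purePower_substX_iff`, `won_subst_iff`, `won_unit_mul_iff`), so nothing is lost.
`wildPurelyInseparableReductionWon_of_descent₃`: S3πM VERBATIM from a normalised datum.
-/

set_option linter.dupNamespace false -- mandated namespace of this single-conjunct summit

namespace Summit.ResolutionOfSingularities.ResolutionOfSingularities.Theorems

open Literature.AlgebraicGeometry.Resolution

namespace WildPurePower

open MvPowerSeries WildTerminal Literature.AlgebraicGeometry.Resolution.CobordantGame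

variable {k : Type} [Field k]

/-! ### The slot-`1` slice of the point chart is a rescaled slope chart of the swapped series -/

/-- The slice `i = 1` after the weight-`(1,1)` chart `c` is `(x(c₀ + y), c₁ x)`, i.e. for `c₁ ≠ 0` the rescaling
`(c₁ x, c₁⁻¹ y)` after the chart of slope `c₀ / c₁` applied to the series with its two letters exchanged. -/
theorem slice_one_chart_swap {c : Fin 2 → k} (h1 : c 1 ≠ 0) (b : MvPowerSeries (Fin 2) k) :
    TupleGame.slice (1 : Fin 2) (subst (CobordantChart.chart (fun _ : Fin 2 => 1) c) b) =
      subst (PlaneGerm.diagScale (c 1) (c 1)⁻¹) (subst (PlaneGerm.dirChart (c 0 / c 1))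
        (rename (Equiv.swap (0 : Fin 2) 1) b)) := by
  have hS : HasSubst (![X 0, X 1, 0] : Fin 3 → MvPowerSeries (Fin 2) k) :=
    hasSubst_of_constantCoeff_zero fun j => by fin_cases j <;> simp [constantCoeff_X]
  have hD := PlaneGerm.hasSubst_diagScale (c 1) (c 1)⁻¹
  have hT := PlaneGerm.hasSubst_dirChart (k := k) (c 0 / c 1)
  unfold TupleGame.slice
  rw [BlowupScaling.slice_one_eq,
    subst_comp_subst_apply (CobordantChart.hasSubst_chart _ c (BlowupScaling.chart_convention c)) hS,
    rename_eq_subst, subst_comp_subst_apply (HasSubst.X_comp _) hT, subst_comp_subst_apply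
      (hasSubst_of_constantCoeff_zero fun s => by
        rw [Function.comp_apply, subst_X hT]; exact PlaneGerm.constantCoeff_dirChart _ _) hD]
  congr 1
  funext s
  simp only [CobordantChart.chart_apply, pow_one, subst_mul hS, subst_add hS, subst_C, subst_X hS,
    Function.comp_apply, subst_X hT]
  fin_cases s
  · simp only [Fin.mk_zero, Fin.succ_zero_eq_one, Matrix.cons_val_zero, Matrix.cons_val_one,
      Equiv.swap_apply_left, PlaneGerm.dirChart_one, subst_mul hD, subst_add hD, subst_C, subst_X hD,
      PlaneGerm.diagScale_zero, PlaneGerm.diagScale_one, div_eq_mul_inv, map_mul]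
    linear_combination (-(X (0 : Fin 2) * (C (c 0) + X 1))) * BlowupScaling.C_mul_C_inv h1
  · simp only [Fin.mk_one, Fin.succ_one_eq_two, Matrix.cons_val_two, Matrix.tail_cons, Matrix.head_cons,
      Matrix.cons_val_zero, Equiv.swap_apply_right, PlaneGerm.dirChart_zero, subst_X hD, PlaneGerm.diagScale_zero]
    ring

/-- The slice `i = 0` after the weight-`(1,1)` chart `c`, `c₀ ≠ 0`: the rescaling `(c₀ x, c₀⁻¹ y)` after the chart of
slope `c₁ / c₀` (`BlowupScaling.slice_zero_chart`, restated for `TupleGame.slice`). -/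
theorem slice_zero_chart' {c : Fin 2 → k} (h0 : c 0 ≠ 0) (b : MvPowerSeries (Fin 2) k) :
    TupleGame.slice (0 : Fin 2) (subst (CobordantChart.chart (fun _ : Fin 2 => 1) c) b) =
      subst (PlaneGerm.diagScale (c 0) (c 0)⁻¹) (subst (PlaneGerm.dirChart (c 1 / c 0)) b) := by
  unfold TupleGame.slice
  exact BlowupScaling.slice_zero_chart h0 b

/-! ### Rescaled pure-power forms -/

/-- The linear part of the diagonal scaling. -/
theorem linMat_diagScale_det (α β : k) : (FormalCoordChange.linMat (PlaneGerm.diagScale α β)).det = α * β := by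
  rw [Matrix.det_fin_two]
  simp [FormalCoordChange.linMat, PlaneGerm.diagScale, coeff_X, Finsupp.single_eq_single_iff]

/-- RESCALINGS ARE FREE: for `γ ≠ 0`, `y^q + γ^q · T(γx, γ⁻¹y)` is won iff `y^q + T` is — the plane change
`(γx, γ⁻¹y)`, then `y ↦ γ⁻¹ y` together with the unit `γ^{-q}`. -/
theorem won_purePower_scale_iff {γ : k} (hγ : γ ≠ 0) (q : ℕ) (T : MvPowerSeries (Fin 2) k) :
    CobordantGame.Won k (2 + 1) (X (Fin.last 2) ^ q + rename (Fin.succAboveEmb (Fin.last 2))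
        (C (γ ^ q) * subst (PlaneGerm.diagScale γ γ⁻¹) T)) ↔
      CobordantGame.Won k (2 + 1) (X (Fin.last 2) ^ q + rename (Fin.succAboveEmb (Fin.last 2)) T) := by
  -- the plane rescaling
  have h1 : CobordantGame.Won k (2 + 1) (X (Fin.last 2) ^ q + rename (Fin.succAboveEmb (Fin.last 2))
        (C (γ ^ q) * subst (PlaneGerm.diagScale γ γ⁻¹) T)) ↔
      CobordantGame.Won k (2 + 1) (X (Fin.last 2) ^ q + rename (Fin.succAboveEmb (Fin.last 2)) (C (γ ^ q) * T)) := by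
    rw [← BlowupScaling.subst_diagScale_C_mul]
    exact won_purePower_substX_iff _ (PlaneGerm.constantCoeff_diagScale γ γ⁻¹)
      (by rw [linMat_diagScale_det, mul_inv_cancel₀ hγ]; exact isUnit_one) q _
  rw [h1]
  -- `y ↦ γ⁻¹ y` and the unit `γ^{-q}`
  set Ψ : Fin (2 + 1) → MvPowerSeries (Fin (2 + 1)) k :=
    fun j => if j = Fin.last 2 then C γ⁻¹ * X j else X j with hΨ
  have hΨlast : Ψ (Fin.last 2) = C γ⁻¹ * X (Fin.last 2) := by simp [hΨ]
  have hΨcast : ∀ i : Fin 2, Ψ (Fin.castSucc i) = X (Fin.castSucc i) := fun i => by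
    show (if Fin.castSucc i = Fin.last 2 then C γ⁻¹ * X (Fin.castSucc i) else X (Fin.castSucc i)) = X (Fin.castSucc i)
    rw [if_neg (Fin.castSucc_lt_last i).ne]
  have hΨ0 : ∀ j, constantCoeff (Ψ j) = 0 := fun j => by
    refine Fin.lastCases ?_ (fun i => ?_) j
    · rw [hΨlast, map_mul, constantCoeff_X, mul_zero]
    · rw [hΨcast, constantCoeff_X]
  have rename_C' : ∀ a : k, rename (Fin.succAboveEmb (Fin.last 2)) (C a : MvPowerSeries (Fin 2) k) =
      (C a : MvPowerSeries (Fin (2 + 1)) k) := fun a => by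
    rw [← monomial_zero_eq_C_apply, rename_monomial, Finsupp.mapDomain_zero, monomial_zero_eq_C_apply]
  have hΨs : HasSubst Ψ := hasSubst_of_constantCoeff_zero hΨ0
  have hΨdet : IsUnit (FormalCoordChange.linMat Ψ).det := by
    have hM : FormalCoordChange.linMat Ψ = Matrix.diagonal (fun j : Fin (2 + 1) => if j = Fin.last 2 then γ⁻¹ else 1) := by
      ext i j
      rw [FormalCoordChange.linMat, Matrix.of_apply, Matrix.diagonal_apply, hΨ]
      by_cases hi : i = Fin.last 2
      · simp only [hi, if_true, coeff_C_mul, coeff_X, Finsupp.single_eq_single_iff, one_ne_zero, and_true,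
          and_self, or_false]
        by_cases hj : Fin.last 2 = j
        · subst hj; simp
        · rw [if_neg (fun h => hj h.symm), if_neg hj, mul_zero]
      · simp only [if_neg hi, coeff_X, Finsupp.single_eq_single_iff, one_ne_zero, and_true, and_self, or_false]
        by_cases hj : i = j
        · subst hj; simp
        · rw [if_neg (fun h => hj h.symm), if_neg hj]
    rw [hM, Matrix.det_diagonal]
    refine IsUnit.ne_zero ?_ |> isUnit_iff_ne_zero.mpr
    exact isUnit_iff_ne_zero.mpr (Finset.prod_ne_zero_iff.mpr fun j _ => by
      split_ifs
      · exact inv_ne_zero hγ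
      · exact one_ne_zero)
  have hren : subst Ψ (rename (Fin.succAboveEmb (Fin.last 2)) T) = rename (Fin.succAboveEmb (Fin.last 2)) T := by
    rw [subst_rename_eq _ Ψ hΨ0 T, rename_eq_subst]
    congr 1
    funext i
    have hi : (Fin.succAboveEmb (Fin.last 2)) i = Fin.castSucc i := by
      rw [Fin.coe_succAboveEmb, Fin.succAbove_last]
    rw [Function.comp_apply, hi, hΨcast]
  have hkey : subst Ψ (X (Fin.last 2) ^ q + rename (Fin.succAboveEmb (Fin.last 2)) T) =
      C (γ⁻¹ ^ q) * (X (Fin.last 2) ^ q + rename (Fin.succAboveEmb (Fin.last 2)) (C (γ ^ q) * T)) := by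
    rw [← coe_substAlgHom hΨs, map_add, map_pow, coe_substAlgHom, subst_X hΨs, hren, hΨlast,
      map_mul (rename _), rename_C', mul_add, ← mul_assoc (C (γ⁻¹ ^ q)), ← map_mul, ← mul_pow,
      inv_mul_cancel₀ hγ, one_pow, map_one, one_mul, mul_pow, map_pow]
  rw [← won_subst_iff hΨ0 hΨdet (X (Fin.last 2) ^ q + rename (Fin.succAboveEmb (Fin.last 2)) T), hkey]
  exact (won_unit_mul_iff (by rw [constantCoeff_C]; exact pow_ne_zero q (inv_ne_zero hγ)) _).symm

/-! ### The normalised descent lift -/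

/-- THE DESCENT LIFT FOR `y^q + A₀(x₁,x₂)`, NORMALISED VERSION (`q = p^e`, `k` algebraically closed of characteristic
`p`).  As `purePower_won_of_descent₂`, except for the point-blow-up clause of the step property: at an exceptional point
`c = (c₀, c₁) ≠ 0` the datum serves, at its choice, EITHER (if `c₀ ≠ 0`) the series `T` with
`x^q · T = A₁(x, x(c₁/c₀ + y))` (`PlaneGerm.dirChart`), OR (if `c₁ ≠ 0`) the series `T` with
`x^q · T = A₁^{sw}(x, x(c₀/c₁ + y))`, `A₁^{sw}` the letter swap of `A₁`; in both cases the exceptional letter of the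
successor is `x = X 0` and the successor point is its origin. -/
theorem purePower_won_of_descent₃ (p : ℕ) (hp : p.Prime) (k : Type) [Field k] [CharP k p] [IsAlgClosed k] (e : ℕ)
    (hord : ∀ g : MvPowerSeries (Fin 3) k, CobordantGame.IsSingular k g → g.order < (p ^ e : ℕ) →
      CobordantGame.Won k 3 g)
    (haxis : ∀ g : MvPowerSeries (Fin 3) k, CobordantGame.IsSingular k g → g.order = (p ^ e : ℕ) →
      (∃ c : Fin 3 → k, c ≠ 0 ∧ ∀ v : Fin 3 → k,
        CobordantChart.initEval (fun _ : Fin 3 => 1) (v + c) (p ^ e) g =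
          CobordantChart.initEval (fun _ : Fin 3 => 1) v (p ^ e) g) →
      (∀ c₁ c₂ : Fin 3 → k,
        (∀ v : Fin 3 → k, CobordantChart.initEval (fun _ : Fin 3 => 1) (v + c₁) (p ^ e) g =
          CobordantChart.initEval (fun _ : Fin 3 => 1) v (p ^ e) g) →
        (∀ v : Fin 3 → k, CobordantChart.initEval (fun _ : Fin 3 => 1) (v + c₂) (p ^ e) g =
          CobordantChart.initEval (fun _ : Fin 3 => 1) v (p ^ e) g) →
        ∃ α β : k, (α ≠ 0 ∨ β ≠ 0) ∧ α • c₁ + β • c₂ = 0) →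
      CobordantGame.Won k 3 g)
    (hterm : ∀ (A₀ : MvPowerSeries (Fin 2) k), ((p ^ e : ℕ) : ℕ∞) < A₀.order →
      ((∃ (r s : ℕ) (U : MvPowerSeries (Fin 2) k), constantCoeff U ≠ 0 ∧ ¬ (p ^ e ∣ r ∧ p ^ e ∣ s) ∧
          A₀ = X (0 : Fin 2) ^ r * X (1 : Fin 2) ^ s * U) ∨
        (∃ (i : Fin 2) (m : ℕ) (g : MvPowerSeries (Fin 2) k), 0 < m ∧ 0 < g.order ∧ g.order < (p ^ e : ℕ) ∧
          A₀ = X i ^ (p ^ e * m) * g)) →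
      CobordantGame.Won k 3 (X (Fin.last 2) ^ (p ^ e) + rename (Fin.succAboveEmb (Fin.last 2)) A₀))
    {S : Type*} (germ : S → MvPowerSeries (Fin 2) k) (μ : S → Ordinal.{0})
    (hstep : ∀ s : S, ((p ^ e : ℕ) : ℕ∞) < (germ s).order →
      (∀ χ : MvPowerSeries (Fin 2) k, constantCoeff χ = 0 → germ s ≠ χ ^ (p ^ e)) →
      ∃ (θ : Fin 2 → MvPowerSeries (Fin 2) k) (φ : MvPowerSeries (Fin 2) k),
        (∀ i, constantCoeff (θ i) = 0) ∧ IsUnit (FormalCoordChange.linMat θ).det ∧ constantCoeff φ = 0 ∧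
        ((p ^ e : ℕ) : ℕ∞) < (subst θ (germ s) + φ ^ (p ^ e)).order ∧
        ((∃ χ : MvPowerSeries (Fin 2) k, constantCoeff χ = 0 ∧ subst θ (germ s) + φ ^ (p ^ e) = χ ^ (p ^ e)) ∨
          ((∃ (r t : ℕ) (U : MvPowerSeries (Fin 2) k), constantCoeff U ≠ 0 ∧ ¬ (p ^ e ∣ r ∧ p ^ e ∣ t) ∧
              subst θ (germ s) + φ ^ (p ^ e) = X (0 : Fin 2) ^ r * X (1 : Fin 2) ^ t * U) ∨
            (∃ (i : Fin 2) (m : ℕ) (g : MvPowerSeries (Fin 2) k), 0 < m ∧ 0 < g.order ∧ g.order < (p ^ e : ℕ) ∧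
              subst θ (germ s) + φ ^ (p ^ e) = X i ^ (p ^ e * m) * g)) ∨
          (∀ (c : Fin 2 → k), (∃ i, c i ≠ 0) →
            (c 0 ≠ 0 ∧ ∀ T : MvPowerSeries (Fin 2) k,
              X 0 ^ (p ^ e) * T = subst (PlaneGerm.dirChart (c 1 / c 0)) (subst θ (germ s) + φ ^ (p ^ e)) →
              ∀ φ' : MvPowerSeries (Fin 2) k, constantCoeff φ' = 0 →
              ((p ^ e : ℕ) : ℕ∞) < (T + φ' ^ (p ^ e)).order →
              (∀ χ : MvPowerSeries (Fin 2) k, constantCoeff χ = 0 → T + φ' ^ (p ^ e) ≠ χ ^ (p ^ e)) →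
              ∃ s' : S, germ s' = T + φ' ^ (p ^ e) ∧ μ s' < μ s) ∨
            (c 1 ≠ 0 ∧ ∀ T : MvPowerSeries (Fin 2) k,
              X 0 ^ (p ^ e) * T = subst (PlaneGerm.dirChart (c 0 / c 1))
                (rename (Equiv.swap (0 : Fin 2) 1) (subst θ (germ s) + φ ^ (p ^ e))) →
              ∀ φ' : MvPowerSeries (Fin 2) k, constantCoeff φ' = 0 →
              ((p ^ e : ℕ) : ℕ∞) < (T + φ' ^ (p ^ e)).order →
              (∀ χ : MvPowerSeries (Fin 2) k, constantCoeff χ = 0 → T + φ' ^ (p ^ e) ≠ χ ^ (p ^ e)) →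
              ∃ s' : S, germ s' = T + φ' ^ (p ^ e) ∧ μ s' < μ s)))) :
    ∀ s : S, ((p ^ e : ℕ) : ℕ∞) < (germ s).order →
      (∀ χ : MvPowerSeries (Fin 2) k, constantCoeff χ = 0 → germ s ≠ χ ^ (p ^ e)) →
      CobordantGame.Won k (2 + 1) (X (Fin.last 2) ^ (p ^ e) + rename (Fin.succAboveEmb (Fin.last 2)) (germ s)) := by
  classical
  set q := p ^ e with hq
  have hq0 : 0 < q := pow_pos hp.pos e
  suffices key : ∀ (α : Ordinal.{0}) (s : S), μ s = α → ((q : ℕ) : ℕ∞) < (germ s).order →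
      (∀ χ : MvPowerSeries (Fin 2) k, constantCoeff χ = 0 → germ s ≠ χ ^ q) →
      Won k (2 + 1) (X (Fin.last 2) ^ q + rename (Fin.succAboveEmb (Fin.last 2)) (germ s)) from
    fun s hs hns => key _ s rfl hs hns
  intro α
  induction α using WellFoundedLT.induction with
  | ind α ih =>
  intro s hα hs hns
  obtain ⟨θ, φ, hθ0, hθdet, hφ0, hA₁, hbr⟩ := hstep s hs hns
  -- the free moves: plane change, then cleaning
  rw [← won_purePower_substX_iff θ hθ0 hθdet, ← won_purePower_recentre_iff p hp e φ hφ0]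
  set A₁ := subst θ (germ s) + φ ^ q with hA₁def
  rcases hbr with ⟨χ, hχ0, hχ⟩ | hT | hpt
  · rw [hχ]
    exact won_purePower_of_qthPower p hp e χ hχ0
  · exact hterm A₁ hA₁ hT
  · -- the point blow-up, one slot per exceptional point, successor read in its normal form
    refine won_purePower_of_pointStep_slot p hp k hq0 A₁ hA₁ fun c hc B₀ hB => ?_
    have hX0 : (X 0 : MvPowerSeries (Fin 2) k) ^ q ≠ 0 := pow_ne_zero _ (FormalCoordChange.X_ne_zero' 0)
    -- the normal form `T'` of the successor at the chosen slot, and the transport of `Won`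
    have hnorm : ∀ (i₀ : Fin 2) (γ t : k) (A' : MvPowerSeries (Fin 2) k), γ ≠ 0 →
        TupleGame.slice i₀ (subst (CobordantChart.chart (fun _ : Fin 2 => 1) c) A₁) =
          subst (PlaneGerm.diagScale γ γ⁻¹) (subst (PlaneGerm.dirChart t) A') →
        ∃ T' : MvPowerSeries (Fin 2) k, X 0 ^ q * T' = subst (PlaneGerm.dirChart t) A' ∧
          TupleGame.slice i₀ (X 0 * B₀) = C (γ ^ q) * subst (PlaneGerm.diagScale γ γ⁻¹) T' := by
      intro i₀ γ t A' hγ hsl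
      have hTa : X 0 ^ q * TupleGame.slice i₀ (X 0 * B₀) =
          subst (PlaneGerm.diagScale γ γ⁻¹) (subst (PlaneGerm.dirChart t) A') := by
        rw [← hsl, hB, MultiplicityLift.slice_X_zero_pow_mul, slice_mul, slice_X_zero]
        ring
      refine ⟨C (γ⁻¹ ^ q) * subst (PlaneGerm.diagScale γ⁻¹ γ⁻¹⁻¹) (TupleGame.slice i₀ (X 0 * B₀)), ?_, ?_⟩
      · have h1 : subst (PlaneGerm.diagScale γ⁻¹ γ⁻¹⁻¹) (X 0 ^ q * TupleGame.slice i₀ (X 0 * B₀)) =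
            subst (PlaneGerm.dirChart t) A' := by
          rw [hTa, BlowupScaling.subst_diagScale_subst_diagScale, mul_inv_cancel₀ hγ, inv_inv, inv_mul_cancel₀ hγ,
            BlowupScaling.subst_diagScale_one]
        have hD := PlaneGerm.hasSubst_diagScale (k := k) γ⁻¹ γ⁻¹⁻¹
        rw [← h1, subst_mul hD, subst_pow hD, subst_X hD, PlaneGerm.diagScale_zero, mul_pow, ← map_pow]
        ring
      · rw [BlowupScaling.subst_diagScale_C_mul, inv_inv, BlowupScaling.subst_diagScale_subst_diagScale,
          inv_mul_cancel₀ hγ, mul_inv_cancel₀ hγ, BlowupScaling.subst_diagScale_one, ← mul_assoc, ← map_mul,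
          ← mul_pow, mul_inv_cancel₀ hγ, one_pow, map_one, one_mul]
    -- the exit analysis on a normal form `T'` served by the datum
    have hplay : ∀ T' : MvPowerSeries (Fin 2) k,
        (∀ φ' : MvPowerSeries (Fin 2) k, constantCoeff φ' = 0 → ((q : ℕ) : ℕ∞) < (T' + φ' ^ q).order →
          (∀ χ : MvPowerSeries (Fin 2) k, constantCoeff χ = 0 → T' + φ' ^ q ≠ χ ^ q) →
          ∃ s' : S, germ s' = T' + φ' ^ q ∧ μ s' < μ s) →
        Won k (2 + 1) (X (Fin.last 2) ^ q + rename (Fin.succAboveEmb (Fin.last 2)) T') := by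
      intro T' hsl
      by_cases hSs : CobordantGame.IsSingular k
          ((X (Fin.last 2) : MvPowerSeries (Fin (2 + 1)) k) ^ q + rename (Fin.succAboveEmb (Fin.last 2)) T')
      swap
      · exact (wonBy_zero_of_not_isSingular (Nat.succ_pos 2) hSs).won
      by_cases hTlt : T'.order < (q : ℕ)
      · exact hord _ hSs (lt_of_le_of_lt (order_X_pow_add_rename_le hq0 T') hTlt)
      rw [not_lt] at hTlt
      have hSq : ((X (Fin.last 2) : MvPowerSeries (Fin (2 + 1)) k) ^ q +
          rename (Fin.succAboveEmb (Fin.last 2)) T').order = q :=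
        order_X_pow_add_rename_eq hq0 T' hTlt
      by_cases hwide : ∃ c₁ c₂ : Fin 3 → k, (∀ α β : k, α • c₁ + β • c₂ = 0 → α = 0 ∧ β = 0) ∧
          (∀ v : Fin 3 → k, CobordantChart.initEval (fun _ : Fin 3 => 1) (v + c₁) q
            ((X (Fin.last 2) : MvPowerSeries (Fin (2 + 1)) k) ^ q + rename (Fin.succAboveEmb (Fin.last 2)) T') =
            CobordantChart.initEval (fun _ : Fin 3 => 1) v q
            ((X (Fin.last 2) : MvPowerSeries (Fin (2 + 1)) k) ^ q + rename (Fin.succAboveEmb (Fin.last 2)) T')) ∧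
          (∀ v : Fin 3 → k, CobordantChart.initEval (fun _ : Fin 3 => 1) (v + c₂) q
            ((X (Fin.last 2) : MvPowerSeries (Fin (2 + 1)) k) ^ q + rename (Fin.succAboveEmb (Fin.last 2)) T') =
            CobordantChart.initEval (fun _ : Fin 3 => 1) v q
            ((X (Fin.last 2) : MvPowerSeries (Fin (2 + 1)) k) ^ q + rename (Fin.succAboveEmb (Fin.last 2)) T'))
      · obtain ⟨c₁, c₂, hind, h₁, h₂⟩ := hwide
        obtain ⟨φ', hφ'0, hφ'ord, hiff⟩ := exists_recentre_of_wide p hp k e T' hTlt c₁ c₂ hind h₁ h₂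
        rw [hiff]
        by_cases hQ : ∃ χ : MvPowerSeries (Fin 2) k, constantCoeff χ = 0 ∧ T' + φ' ^ q = χ ^ q
        · obtain ⟨χ, hχ0, hχ⟩ := hQ
          rw [hχ]
          exact won_purePower_of_qthPower p hp e χ hχ0
        · push Not at hQ
          obtain ⟨s', hs', hμ⟩ := hsl φ' hφ'0 hφ'ord hQ
          rw [← hs']
          exact ih (μ s') (hα ▸ hμ) s' rfl (by rw [hs']; exact hφ'ord) (by rw [hs']; exact hQ)
      · exact won_of_order_eq_of_not_wide p hp k hord haxis _ hSs hSq hwide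
    rcases hpt c hc with ⟨hc0, hsl⟩ | ⟨hc1, hsl⟩
    · obtain ⟨T', hT', hrel⟩ := hnorm 0 (c 0) (c 1 / c 0) A₁ hc0 (slice_zero_chart' hc0 A₁)
      refine ⟨0, hc0, fun _ => ?_⟩
      rw [hrel, won_purePower_scale_iff hc0]
      exact hplay T' (hsl T' hT')
    · obtain ⟨T', hT', hrel⟩ := hnorm 1 (c 1) (c 0 / c 1) _ hc1 (slice_one_chart_swap hc1 A₁)
      refine ⟨1, hc1, fun _ => ?_⟩
      rw [hrel, won_purePower_scale_iff hc1]
      exact hplay T' (hsl T' hT')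

/-- S3πM FROM A NORMALISED DESCENT DATUM: the registered stub `stub_wildPurelyInseparableReductionWon` (skeleton v28)
VERBATIM, as soon as for every algebraically closed field of characteristic `p` and every `q = p^e > 2` (under its side
hypotheses) there are states, coefficients and a measure with the step property of `purePower_won_of_descent₃` covering
every position that is not a `q`-th power. -/
theorem wildPurelyInseparableReductionWon_of_descent₃
    (hdesc : ∀ (p : ℕ), p.Prime → ∀ (k : Type) [Field k] [CharP k p] [IsAlgClosed k] (e : ℕ), 2 < p ^ e →
      (∀ m : ℕ, m < 3 → ∀ g : MvPowerSeries (Fin m) k, CobordantGame.IsSingular k g → CobordantGame.Won k m g) →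
      (∀ g : MvPowerSeries (Fin 3) k, CobordantGame.IsSingular k g → g.order < (p ^ e : ℕ) → CobordantGame.Won k 3 g) →
      (∀ g : MvPowerSeries (Fin 3) k, CobordantGame.IsSingular k g → g.order = (p ^ e : ℕ) →
        (∃ c : Fin 3 → k, c ≠ 0 ∧ ∀ v : Fin 3 → k,
          CobordantChart.initEval (fun _ : Fin 3 => 1) (v + c) (p ^ e) g =
            CobordantChart.initEval (fun _ : Fin 3 => 1) v (p ^ e) g) →
        (∀ c₁ c₂ : Fin 3 → k,
          (∀ v : Fin 3 → k, CobordantChart.initEval (fun _ : Fin 3 => 1) (v + c₁) (p ^ e) g =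
            CobordantChart.initEval (fun _ : Fin 3 => 1) v (p ^ e) g) →
          (∀ v : Fin 3 → k, CobordantChart.initEval (fun _ : Fin 3 => 1) (v + c₂) (p ^ e) g =
            CobordantChart.initEval (fun _ : Fin 3 => 1) v (p ^ e) g) →
          ∃ α β : k, (α ≠ 0 ∨ β ≠ 0) ∧ α • c₁ + β • c₂ = 0) →
        CobordantGame.Won k 3 g) →
      ∃ (S : Type) (germ : S → MvPowerSeries (Fin 2) k) (μ : S → Ordinal.{0}),
        (∀ A₀ : MvPowerSeries (Fin 2) k, ((p ^ e : ℕ) : ℕ∞) < A₀.order →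
          (∀ χ : MvPowerSeries (Fin 2) k, constantCoeff χ = 0 → A₀ ≠ χ ^ (p ^ e)) → ∃ s, germ s = A₀) ∧
        (∀ s : S, ((p ^ e : ℕ) : ℕ∞) < (germ s).order →
          (∀ χ : MvPowerSeries (Fin 2) k, constantCoeff χ = 0 → germ s ≠ χ ^ (p ^ e)) →
          ∃ (θ : Fin 2 → MvPowerSeries (Fin 2) k) (φ : MvPowerSeries (Fin 2) k),
            (∀ i, constantCoeff (θ i) = 0) ∧ IsUnit (FormalCoordChange.linMat θ).det ∧ constantCoeff φ = 0 ∧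
            ((p ^ e : ℕ) : ℕ∞) < (subst θ (germ s) + φ ^ (p ^ e)).order ∧
            ((∃ χ : MvPowerSeries (Fin 2) k, constantCoeff χ = 0 ∧ subst θ (germ s) + φ ^ (p ^ e) = χ ^ (p ^ e)) ∨
              ((∃ (r t : ℕ) (U : MvPowerSeries (Fin 2) k), constantCoeff U ≠ 0 ∧ ¬ (p ^ e ∣ r ∧ p ^ e ∣ t) ∧
                  subst θ (germ s) + φ ^ (p ^ e) = X (0 : Fin 2) ^ r * X (1 : Fin 2) ^ t * U) ∨
                (∃ (i : Fin 2) (m : ℕ) (g : MvPowerSeries (Fin 2) k), 0 < m ∧ 0 < g.order ∧ g.order < (p ^ e : ℕ) ∧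
                  subst θ (germ s) + φ ^ (p ^ e) = X i ^ (p ^ e * m) * g)) ∨
              (∀ (c : Fin 2 → k), (∃ i, c i ≠ 0) →
                (c 0 ≠ 0 ∧ ∀ T : MvPowerSeries (Fin 2) k,
                  X 0 ^ (p ^ e) * T = subst (PlaneGerm.dirChart (c 1 / c 0)) (subst θ (germ s) + φ ^ (p ^ e)) →
                  ∀ φ' : MvPowerSeries (Fin 2) k, constantCoeff φ' = 0 →
                  ((p ^ e : ℕ) : ℕ∞) < (T + φ' ^ (p ^ e)).order →
                  (∀ χ : MvPowerSeries (Fin 2) k, constantCoeff χ = 0 → T + φ' ^ (p ^ e) ≠ χ ^ (p ^ e)) →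
                  ∃ s' : S, germ s' = T + φ' ^ (p ^ e) ∧ μ s' < μ s) ∨
                (c 1 ≠ 0 ∧ ∀ T : MvPowerSeries (Fin 2) k,
                  X 0 ^ (p ^ e) * T = subst (PlaneGerm.dirChart (c 0 / c 1))
                    (rename (Equiv.swap (0 : Fin 2) 1) (subst θ (germ s) + φ ^ (p ^ e))) →
                  ∀ φ' : MvPowerSeries (Fin 2) k, constantCoeff φ' = 0 →
                  ((p ^ e : ℕ) : ℕ∞) < (T + φ' ^ (p ^ e)).order →
                  (∀ χ : MvPowerSeries (Fin 2) k, constantCoeff χ = 0 → T + φ' ^ (p ^ e) ≠ χ ^ (p ^ e)) →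
                  ∃ s' : S, germ s' = T + φ' ^ (p ^ e) ∧ μ s' < μ s))))) :
    ∀ (p : ℕ), p.Prime → ∀ (k : Type) [Field k] [CharP k p] [IsAlgClosed k],
      (∀ m : ℕ, m < 3 → ∀ g : MvPowerSeries (Fin m) k,
        CobordantGame.IsSingular k g → CobordantGame.Won k m g) →
      ∀ (d : ℕ), (∃ e : ℕ, d = p ^ e) → 2 < d →
      (∀ g : MvPowerSeries (Fin 3) k, CobordantGame.IsSingular k g → g.order < d →
        CobordantGame.Won k 3 g) →
      (∀ g : MvPowerSeries (Fin 3) k, CobordantGame.IsSingular k g → g.order = d →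
        (∃ c : Fin 3 → k, c ≠ 0 ∧ ∀ v : Fin 3 → k,
          CobordantChart.initEval (fun _ : Fin 3 => 1) (v + c) d g =
            CobordantChart.initEval (fun _ : Fin 3 => 1) v d g) →
        (∀ c₁ c₂ : Fin 3 → k,
          (∀ v : Fin 3 → k, CobordantChart.initEval (fun _ : Fin 3 => 1) (v + c₁) d g =
            CobordantChart.initEval (fun _ : Fin 3 => 1) v d g) →
          (∀ v : Fin 3 → k, CobordantChart.initEval (fun _ : Fin 3 => 1) (v + c₂) d g =
            CobordantChart.initEval (fun _ : Fin 3 => 1) v d g) →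
          ∃ α β : k, (α ≠ 0 ∨ β ≠ 0) ∧ α • c₁ + β • c₂ = 0) →
        CobordantGame.Won k 3 g) →
      (∀ (A₀ : MvPowerSeries (Fin 2) k), (d : ℕ∞) < A₀.order →
        ((∃ (r s : ℕ) (U : MvPowerSeries (Fin 2) k), MvPowerSeries.constantCoeff U ≠ 0 ∧ ¬ (d ∣ r ∧ d ∣ s) ∧
            A₀ = MvPowerSeries.X (0 : Fin 2) ^ r * MvPowerSeries.X (1 : Fin 2) ^ s * U) ∨
          (∃ (i : Fin 2) (m : ℕ) (g : MvPowerSeries (Fin 2) k), 0 < m ∧ 0 < g.order ∧ g.order < d ∧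
            A₀ = MvPowerSeries.X i ^ (d * m) * g)) →
        CobordantGame.Won k 3 (MvPowerSeries.X (Fin.last 2) ^ d +
          MvPowerSeries.rename (Fin.succAboveEmb (Fin.last 2)) A₀)) →
      ∀ (A₀ : MvPowerSeries (Fin 2) k), (d : ℕ∞) < A₀.order →
        CobordantGame.Won k 3 (MvPowerSeries.X (Fin.last 2) ^ d +
          MvPowerSeries.rename (Fin.succAboveEmb (Fin.last 2)) A₀) := by
  intro p hp k _ _ _ hlow d hpe h2d hord haxis hterm A₀ hA₀
  obtain ⟨e, rfl⟩ := hpe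
  by_cases hQ : ∃ χ : MvPowerSeries (Fin 2) k, constantCoeff χ = 0 ∧ A₀ = χ ^ (p ^ e)
  · obtain ⟨χ, hχ0, rfl⟩ := hQ
    exact won_purePower_of_qthPower p hp e χ hχ0
  push Not at hQ
  obtain ⟨S, germ, μ, hcover, hstep⟩ := hdesc p hp k e h2d hlow hord haxis
  obtain ⟨s, hs⟩ := hcover A₀ hA₀ hQ
  have h := purePower_won_of_descent₃ p hp k e hord haxis hterm germ μ hstep s (by rw [hs]; exact hA₀)
    (by rw [hs]; exact hQ)
  rw [hs] at h
  exact h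

end WildPurePower

end Summit.ResolutionOfSingularities.ResolutionOfSingularities.Theorems
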